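import Summits.Ventures.PercRepro0.Ergodic
import Summits.Ventures.PercRepro0.FiniteEnergyDefs

/-!
# Uniqueness modulo «no three infinite clusters» (UNIQUENESS-p6-v1 §4, Steps 0–2), seat p6

Kernel-checked twin, on `Defs.lean`, of Steps 0, 1 and 2 of the proof of Theorem P3 in
`proofs/UNIQUENESS-p6-v1.md`, together with the lattice facts (N2)/(N6) they use:

* `touching d n` = the bonds meeting the box `Λ_n` (the paper's `F_{n+1}`), a finite set (`touching_finite`);
* (N6) `conn_of_mem_box`: when every bond meeting `Λ_n` is open, any two vertices of `Λ_n` are connected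
  (coordinate-wise unit steps inside the box);
* `conn_of_conn_avoid`: a connection of `ω'` whose cluster avoids `Λ_n` uses exterior bonds only, hence is a
  connection of every `ω ⊇ ω' ∖ F`;
* `atMostOne_of_merge` (Step 2, configuration form): open all bonds meeting `Λ_n` in a configuration all of
  whose infinite clusters meet `Λ_n`; the result has at most one infinite cluster;
* `P_atMostOne_pos` (Step 2): `P_p(N ≥ 2) > 0` and `P_p(N ≥ 3) = 0` give `P_p(N ≤ 1) > 0` (finite energy with
  the constant choice «all bonds of `F` open», `FiniteEnergyDefs.finite_energy_allOpen`);
* `P3_Unique_of_no_three`: for `d ≥ 1`, if `P_p(N ≥ 3) = 0` for every `p` then `P3_Unique d` — Step 0 for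
  `p ∈ {0, 1}` (`setBernoulli_zero/one`), ergodicity (`Ergodic.P_atLeastInf_zero_or_one`) and Step 2 for
  `0 < p < 1`. Step 3 (`P_p(N ≥ 3) = 0`, the trifurcation argument) is the remaining input.
-/

namespace Summit.Ventures.PercRepro0.Merge

open MeasureTheory ProbabilityTheory unitInterval Set Function
open scoped ENNReal
open Summit.Ventures.PercRepro0.Defs
open Summit.Ventures.PercRepro0.Ergodic (atLeastInf measurableSet_atLeastInf P_atLeastInf_zero_or_one
  atMostOneInfCluster_eq_compl)
open Summit.Ventures.PercRepro0.FiniteEnergyDefs (feConst feConst_pos finite_energy_allOpen)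
open Summit.Ventures.PercRepro0.L2 (extCfg)

variable {d : ℕ}

/-! ## Lattice geometry: bonds meeting a box, and box connectivity -/

/-- The bonds with at least one endpoint in the box `Λ_n` (the paper's `F_{n+1}`). -/
def touching (d n : ℕ) : Set (Sym2 (Vertex d)) := {e | e ∈ bonds d ∧ ∃ v ∈ e, v ∈ box d n}

/-- (N1) A lattice neighbour of a vertex of `Λ_n` lies in `Λ_{n+1}`. -/
theorem mem_box_succ_of_adj {n : ℕ} {v w : Vertex d} (h : (lattice d).Adj v w) (hv : v ∈ box d n) :
    w ∈ box d (n + 1) := by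
  intro i
  have hsum : (∑ j, |v j - w j|) = 1 := h
  have h1 : |v i - w i| ≤ 1 := by
    rw [← hsum]
    exact Finset.single_le_sum (fun j _ => abs_nonneg (v j - w j)) (Finset.mem_univ i)
  have h2 : |v i| ≤ n := hv i
  have h3 : |w i| ≤ |v i| + |v i - w i| := by
    calc |w i| = |v i - (v i - w i)| := by ring_nf
      _ ≤ |v i| + |v i - w i| := abs_sub _ _
  push_cast
  linarith

/-- The bonds meeting a box form a finite set. -/
theorem touching_finite (n : ℕ) : (touching d n).Finite := by
  refine (((box_finite (d := d) n).prod (box_finite (d := d) (n + 1))).image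
    fun q : Vertex d × Vertex d => s(q.1, q.2)).subset ?_
  rintro e ⟨he, v, hv, hvbox⟩
  induction e using Sym2.ind with
  | h a b =>
    have hadj : (lattice d).Adj a b := he
    rw [Sym2.mem_iff] at hv
    rcases hv with rfl | rfl
    · exact ⟨(v, b), ⟨hvbox, mem_box_succ_of_adj hadj hvbox⟩, rfl⟩
    · exact ⟨(v, a), ⟨hvbox, mem_box_succ_of_adj hadj.symm hvbox⟩, Sym2.eq_swap⟩

/-- (N6) Box connectivity: if every bond meeting `Λ_n` is open, any two vertices of `Λ_n` are connected. -/
theorem conn_of_mem_box {ω : Config d} {n : ℕ} (hω : ∀ e ∈ touching d n, e ∈ ω) {a b : Vertex d}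
    (ha : a ∈ box d n) (hb : b ∈ box d n) : Conn d ω a b := by
  classical
  suffices h : ∀ (m : ℕ) (a : Vertex d), a ∈ box d n → (∑ i, (b i - a i).natAbs) = m → Conn d ω a b from
    h _ a ha rfl
  intro m
  induction m with
  | zero =>
    intro a _ hm
    have : a = b := by
      funext i
      have h0 := (Finset.sum_eq_zero_iff.1 hm) i (Finset.mem_univ i)
      have := Int.natAbs_eq_zero.1 h0
      linarith
    subst this
    exact SimpleGraph.Reachable.refl _
  | succ m ih =>
    intro a ha hm
    obtain ⟨i, hi⟩ : ∃ i, a i ≠ b i := by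
      by_contra h
      push Not at h
      have : (∑ i, (b i - a i).natAbs) = 0 := Finset.sum_eq_zero fun i _ => by rw [h i]; simp
      omega
    -- one unit step in coordinate `i` towards `b`
    set δ : ℤ := if a i < b i then 1 else -1 with hδ
    set a' : Vertex d := Function.update a i (a i + δ) with ha'def
    have ha'i : a' i = a i + δ := by simp [ha'def]
    have ha'j : ∀ j, j ≠ i → a' j = a j := fun j hj => by simp [ha'def, hj]
    have hai : |a i| ≤ n := ha i
    have hbi : |b i| ≤ n := hb i
    have ha' : a' ∈ box d n := by
      intro j
      by_cases hj : j = i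
      · subst hj
        rw [ha'i]
        rw [abs_le] at hai hbi ⊢
        rw [hδ]
        split_ifs with hlt
        · constructor <;> linarith
        · constructor <;> linarith [lt_of_le_of_ne (not_lt.1 hlt) (Ne.symm hi)]
      · rw [ha'j j hj]
        exact ha j
    have hadj : (lattice d).Adj a a' := by
      show (∑ j, |a j - a' j|) = 1
      rw [Finset.sum_eq_single i]
      · rw [ha'i, hδ]
        split_ifs <;> simp
      · intro j _ hj
        rw [ha'j j hj, sub_self, abs_zero]
      · intro h
        exact absurd (Finset.mem_univ i) h
    have hbond : s(a, a') ∈ touching d n := ⟨hadj, a, by simp, ha⟩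
    have hopen : (openGraph d ω).Adj a a' := by
      rw [openGraph, SimpleGraph.fromEdgeSet_adj]
      exact ⟨⟨hω _ hbond, hbond.1⟩, (lattice d).ne_of_adj hadj⟩
    have hm' : (∑ j, (b j - a' j).natAbs) = m := by
      have hstep : ∀ j, (b j - a' j).natAbs + (if j = i then 1 else 0) = (b j - a j).natAbs := by
        intro j
        by_cases hj : j = i
        · subst hj
          rw [ha'i, hδ]
          simp only [if_true]
          split_ifs with hlt
          · omega
          · have := lt_of_le_of_ne (not_lt.1 hlt) (Ne.symm hi)
            omega
        · rw [ha'j j hj]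
          simp [hj]
      have hsum := Finset.sum_congr rfl fun j (_ : j ∈ Finset.univ) => hstep j
      rw [Finset.sum_add_distrib, Finset.sum_ite_eq' Finset.univ i, if_pos (Finset.mem_univ i),
        hm] at hsum
      omega
    exact hopen.reachable.trans (ih a' ha' hm')

/-- A walk of `ω'` starting at a vertex whose cluster avoids `Λ_n` uses only bonds not meeting `Λ_n`;
so it is a walk of every `ω` containing the exterior bonds of `ω'`. -/
theorem conn_of_conn_avoid {ω ω' : Config d} {n : ℕ} (hext : ∀ e ∈ ω', e ∉ touching d n → e ∈ ω) :
    ∀ {x z : Vertex d}, (openGraph d ω').Walk x z → (∀ b ∈ box d n, ¬ Conn d ω' x b) → Conn d ω x z := by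
  intro x z w
  induction w with
  | nil => intro _; exact SimpleGraph.Reachable.refl _
  | @cons u v z hadj w ih =>
    intro hu
    have huv : Conn d ω' u v := hadj.reachable
    have hv : ∀ b ∈ box d n, ¬ Conn d ω' v b := fun b hb hvb => hu b hb (huv.trans hvb)
    have hadj' : (openGraph d ω).Adj u v := by
      rw [openGraph, SimpleGraph.fromEdgeSet_adj] at hadj ⊢
      refine ⟨⟨hext _ hadj.1.1 ?_, hadj.1.2⟩, hadj.2⟩
      rintro ⟨_, y, hy, hybox⟩
      rw [Sym2.mem_iff] at hy
      rcases hy with rfl | rfl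
      · exact hu y hybox (SimpleGraph.Reachable.refl _)
      · exact hu y hybox huv
    exact hadj'.reachable.trans (ih hv)

/-! ## Step 2, configuration form -/

/-- Step 2 (configuration form): let `F` be the bonds meeting `Λ_n`, `ω' ⊇ F`, `ω ⊆ ω'` with
`ω' ∖ F ⊆ ω`, and suppose every infinite cluster of `ω` meets `Λ_n`. Then `ω'` has at most one infinite
cluster. -/
theorem atMostOne_of_merge {ω ω' : Config d} {n : ℕ} (hF : ∀ e ∈ touching d n, e ∈ ω')
    (hsub : ω ⊆ ω') (hext : ∀ e ∈ ω', e ∉ touching d n → e ∈ ω)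
    (hmeet : ∀ x, ConnInf d ω x → ∃ y ∈ box d n, Conn d ω x y) :
    ω' ∈ atMostOneInfCluster d := by
  -- every infinite cluster of `ω'` meets the box
  have key : ∀ x, ConnInf d ω' x → ∃ b ∈ box d n, Conn d ω' x b := by
    intro x hx
    by_contra h
    push Not at h
    have hsubcl : cluster d ω' x ⊆ cluster d ω x := by
      intro z hz
      obtain ⟨w⟩ := hz
      exact conn_of_conn_avoid hext w h
    have hx' : ConnInf d ω x := hx.mono hsubcl
    obtain ⟨y, hy, hxy⟩ := hmeet x hx'
    exact h y hy (conn_mono hsub hxy)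
  intro x y hx hy
  obtain ⟨b, hb, hxb⟩ := key x hx
  obtain ⟨b', hb', hyb'⟩ := key y hy
  exact hxb.trans ((conn_of_mem_box hF hb hb').trans hyb'.symm)

/-! ## Step 2, probabilistic form -/

/-- Three vertices in pairwise distinct infinite clusters witness `N ≥ 3`. -/
theorem mem_atLeastInf_three {ω : Config d} {a b c : Vertex d} (ha : ConnInf d ω a) (hb : ConnInf d ω b)
    (hc : ConnInf d ω c) (hab : ¬ Conn d ω a b) (hac : ¬ Conn d ω a c) (hbc : ¬ Conn d ω b c) :
    ω ∈ atLeastInf d 3 := by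
  refine ⟨![a, b, c], fun i => ?_, fun i j hij => ?_⟩
  · fin_cases i <;> assumption
  · fin_cases i <;> fin_cases j
    all_goals first
      | exact absurd rfl hij
      | assumption
      | exact fun h => hab h.symm
      | exact fun h => hac h.symm
      | exact fun h => hbc h.symm

/-- The event «every infinite cluster meets `Λ_n`» is measurable. -/
theorem measurableSet_allMeetBox (n : ℕ) :
    MeasurableSet {ω : Config d | ∀ x, ConnInf d ω x → ∃ y ∈ box d n, Conn d ω x y} := by
  have : {ω : Config d | ∀ x, ConnInf d ω x → ∃ y ∈ box d n, Conn d ω x y} =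
      ⋂ x, ({ω : Config d | ConnInf d ω x}ᶜ ∪ ⋃ y ∈ box d n, {ω : Config d | Conn d ω x y}) := by
    ext ω
    simp only [Set.mem_setOf_eq, Set.mem_iInter, Set.mem_union, Set.mem_compl_iff, Set.mem_iUnion,
      exists_prop]
    exact forall_congr' fun x => by tauto
  rw [this]
  exact MeasurableSet.iInter fun x => (measurableSet_connInf x).compl.union
    (MeasurableSet.biUnion (box_finite n).countable fun y _ => measurableSet_conn x y)

/-- Step 2: `P_p(N ≥ 2) > 0` and `P_p(N ≥ 3) = 0` imply `P_p(N ≤ 1) > 0` (for `0 < p < 1`). -/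
theorem P_atMostOne_pos (p : I) (hp0 : (0 : ℝ) < p) (hp1 : (p : ℝ) < 1)
    (h2 : 0 < P d p (atLeastInf d 2)) (h3 : P d p (atLeastInf d 3) = 0) :
    0 < P d p (atMostOneInfCluster d) := by
  classical
  -- `E = {N ≥ 2} ∖ {N ≥ 3}` has positive probability
  set E : Set (Config d) := atLeastInf d 2 \ atLeastInf d 3 with hEdef
  have hE : 0 < P d p E := by
    rw [hEdef, measure_sdiff_null h3]
    exact h2
  -- `A n = E ∩ {every infinite cluster meets Λ_n}`
  set A : ℕ → Set (Config d) :=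
    fun n => E ∩ {ω | ∀ x, ConnInf d ω x → ∃ y ∈ box d n, Conn d ω x y} with hAdef
  have hA_meas : ∀ n, MeasurableSet (A n) := fun n =>
    ((measurableSet_atLeastInf 2).diff (measurableSet_atLeastInf 3)).inter (measurableSet_allMeetBox n)
  have hE_sub : E ⊆ ⋃ n, A n := by
    rintro ω ⟨⟨x, hx, hxx⟩, h3ω⟩
    -- `n` large enough to contain `x 0` and `x 1`
    set n : ℕ := ((∑ i, |x 0 i|) + ∑ i, |x 1 i|).toNat with hn
    have hbox : ∀ k : Fin 2, x k ∈ box d n := by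
      intro k i
      have h1 : |x k i| ≤ ∑ j, |x k j| :=
        Finset.single_le_sum (fun j _ => abs_nonneg (x k j)) (Finset.mem_univ i)
      have h2 : ∑ j, |x k j| ≤ (∑ i, |x 0 i|) + ∑ i, |x 1 i| := by
        fin_cases k
        · simp only [Fin.zero_eta, Fin.isValue]
          linarith [Finset.sum_nonneg fun j (_ : j ∈ Finset.univ) => abs_nonneg (x 1 j)]
        · simp only [Fin.mk_one, Fin.isValue]
          linarith [Finset.sum_nonneg fun j (_ : j ∈ Finset.univ) => abs_nonneg (x 0 j)]
      rw [hn]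
      exact h1.trans (h2.trans (Int.self_le_toNat _))
    refine Set.mem_iUnion.2 ⟨n, ⟨⟨x, hx, hxx⟩, h3ω⟩, ?_⟩
    intro z hz
    by_cases h0 : Conn d ω z (x 0)
    · exact ⟨x 0, hbox 0, h0⟩
    by_cases h1 : Conn d ω z (x 1)
    · exact ⟨x 1, hbox 1, h1⟩
    exact absurd (mem_atLeastInf_three hz (hx 0) (hx 1) h0 h1 (hxx 0 1 (by decide))) h3ω
  obtain ⟨n, hn⟩ : ∃ n, 0 < P d p (A n) := by
    by_contra h
    push Not at h
    have hnull : P d p (⋃ n, A n) = 0 :=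
      measure_iUnion_null fun n => nonpos_iff_eq_zero.1 (h n)
    exact hE.ne' (measure_mono_null hE_sub hnull)
  -- finite energy: open every bond meeting `Λ_n`
  set F : Finset (Sym2 (Vertex d)) := (touching_finite (d := d) n).toFinset with hFdef
  have hmemF : ∀ e, e ∈ F ↔ e ∈ touching d n := fun e => (touching_finite n).mem_toFinset
  have hF : ∀ e ∈ F, e ∈ bonds d := fun e he => ((hmemF e).1 he).1
  have key := finite_energy_allOpen p F hF (hA_meas n)
  have hpos : 0 < feConst p ^ F.card * P d p (A n) :=
    ENNReal.mul_pos (pow_ne_zero _ (feConst_pos hp0 hp1).ne') hn.ne'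
  refine lt_of_lt_of_le (lt_of_lt_of_le hpos key) (measure_mono ?_)
  -- the modified configurations have at most one infinite cluster
  rintro ω' ⟨hF', η, hω⟩
  refine atMostOne_of_merge (ω := extCfg F η ∪ (ω' \ F)) (n := n) ?_ ?_ ?_ hω.2
  · intro e he
    exact hF' e ((hmemF e).2 he)
  · intro e he
    rcases he with h | h
    · obtain ⟨heF, _⟩ := h
      exact hF' e heF
    · exact h.1
  · intro e he he'
    exact Or.inr ⟨he, fun h => he' ((hmemF e).1 h)⟩

/-! ## Steps 0–2 assembled: uniqueness modulo `P_p(N ≥ 3) = 0` -/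

/-- Step 0, `p = 0`: the empty configuration has no infinite cluster. -/
theorem empty_mem_atMostOne : (∅ : Config d) ∈ atMostOneInfCluster d := by
  intro x _ hx
  exfalso
  apply hx
  rw [cluster_empty]
  exact Set.finite_singleton x

/-- Step 0, `p = 1`: in the full lattice every two vertices are connected. -/
theorem bonds_mem_atMostOne : bonds d ∈ atMostOneInfCluster d := by
  intro x y _ _
  set n : ℕ := ((∑ i, |x i|) + ∑ i, |y i|).toNat with hn
  have hx : x ∈ box d n := by
    intro i
    have h1 : |x i| ≤ ∑ j, |x j| := Finset.single_le_sum (fun j _ => abs_nonneg (x j)) (Finset.mem_univ i)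
    have h2 : ∑ j, |x j| ≤ (∑ i, |x i|) + ∑ i, |y i| := by
      linarith [Finset.sum_nonneg fun j (_ : j ∈ Finset.univ) => abs_nonneg (y j)]
    rw [hn]
    exact h1.trans (h2.trans (Int.self_le_toNat _))
  have hy : y ∈ box d n := by
    intro i
    have h1 : |y i| ≤ ∑ j, |y j| := Finset.single_le_sum (fun j _ => abs_nonneg (y j)) (Finset.mem_univ i)
    have h2 : ∑ j, |y j| ≤ (∑ i, |x i|) + ∑ i, |y i| := by
      linarith [Finset.sum_nonneg fun j (_ : j ∈ Finset.univ) => abs_nonneg (x j)]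
    rw [hn]
    exact h1.trans (h2.trans (Int.self_le_toNat _))
  exact conn_of_mem_box (fun e he => he.1) hx hy

/-- Uniqueness modulo Step 3: for `d ≥ 1`, if `P_p(N ≥ 3) = 0` for every `p`, then `P_p(N ≤ 1) = 1` for
every `p` (`P3_Unique d`). -/
theorem P3_Unique_of_no_three (hd : 1 ≤ d) (h3 : ∀ p : I, P d p (atLeastInf d 3) = 0) :
    P3_Unique d := by
  intro p
  rcases eq_or_lt_of_le p.2.1 with hp0 | hp0
  · -- `p = 0`
    have : p = 0 := Subtype.ext hp0.symm
    subst this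
    show setBernoulli (bonds d) 0 (atMostOneInfCluster d) = 1
    rw [setBernoulli_zero, Measure.dirac_apply_of_mem empty_mem_atMostOne]
  rcases eq_or_lt_of_le p.2.2 with hp1 | hp1
  · -- `p = 1`
    have : p = 1 := Subtype.ext hp1
    subst this
    show setBernoulli (bonds d) 1 (atMostOneInfCluster d) = 1
    rw [setBernoulli_one, Measure.dirac_apply_of_mem bonds_mem_atMostOne]
  -- `0 < p < 1`
  rw [atMostOneInfCluster_eq_compl, prob_compl_eq_one_sub (measurableSet_atLeastInf 2)]
  rcases P_atLeastInf_zero_or_one hd p 2 with h | h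
  · rw [h, tsub_zero]
  · exfalso
    have hpos := P_atMostOne_pos p hp0 hp1 (by rw [h]; exact zero_lt_one) (h3 p)
    rw [atMostOneInfCluster_eq_compl, prob_compl_eq_one_sub (measurableSet_atLeastInf 2), h,
      tsub_self] at hpos
    exact lt_irrefl _ hpos

end Summit.Ventures.PercRepro0.Merge
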